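import Literature.NumberTheory.Automorphic.CompletedCohomologyHeckeAlgebraGLn
import Literature.NumberTheory.Automorphic.HidaHeckeAlgebraPointsIntegral
import Literature.NumberTheory.GaloisRepresentations.ResidualGaloisRepOpenKernel
import HarnessLib

/-!
# The residual eigensystem of a `p`-adically automorphic Galois representation is non-Eisenstein

Topic `NumberTheory/Automorphic`; namespace `Literature.NumberTheory.Automorphic.BigHeckeGLn`
(grouping sub-namespace of the object `𝕋(K^p) = CompletedCohomologyHeckeAlgebraGLn 𝒰`).
THEOREMS ONLY (no definition, no named fact, no `sorry`).

For a number field `K`, a prime `p`, an `S`-good tame level `𝒰 : TameLevel n K p` and a continuous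
`ρ : Γ_K → GL_n(ℚ̄_p)` which is **`p`-adically automorphic of tame level `𝒰`**
(`TameLevel.IsPadicallyAutomorphic`: `ρ` is associated — unramified at `v ∉ S` with
`charpoly ρ(Frob_v) = x(P_v)`, `P_v = heckeFrobPoly n q_v (T_{v,·})` — with a CONTINUOUS point
`x : 𝕋(K^p) → ℚ̄_p`), we prove the elementary dictionary between such points and the residual
vocabulary of `CompletedCohomologyHeckeAlgebraGLn` (`IsPointOver`, `IsResidualRepAt`,
`IsNonEisenstein`), i.e. the sentence "the residual eigensystem `x mod 𝔪` has an open kernel `𝔪`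
whose residual representation is `ρ̄`; `𝔪` is non-Eisenstein when `ρ̄` is absolutely irreducible"
of rendering (a) of `Literature.NumberTheory.Automorphic.Pan2022_proModularDeRhamClassical_GL2Q`
(the passage from the tree's typing of "pro-modular" to the non-Eisenstein localisation
`𝕋(K^p)_𝔪` of [CalegariEmerton2011, §1.8], [GeeNewton2020, §3.3, standing hypotheses after
Def. 3.3.4], [Pan2022LocallyAnalytic, §6.1.1]):

* `TameLevel.natCast_pow_endFactor_eq_zero`, **`TameLevel.norm_apply_le_one`**,
  `TameLevel.apply_mem_padicAlgClIntegers` — `p^s = 0` in the factor `End(H^i(X_{U_r}, ℤ/p^s))`,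
  hence EVERY CONTINUOUS POINT OF `𝕋(K^p)` WITH VALUES IN A NORMED DIVISION RING OF CHARACTERISTIC
  ZERO IS INTEGRAL, `‖x t‖ ≤ 1` (the generic `norm_apply_le_one_of_continuous_of_pow_eq_zero` of
  `HidaHeckeAlgebraPointsIntegral`, there applied to the Hida tower); so `x` corestricts to
  `x₀ : 𝕋(K^p) → ℤ̄_p` ([KhareThorne2017, §6.5]: points of the big Hecke algebra are `𝒪`-valued);
* `BigHeckeGLn.heckeFrobPoly_map` — `heckeFrobPoly` commutes with ring homomorphisms;
* `TameLevel.continuous_residue_comp` — the residual eigensystem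
  `ψ = (x₀ mod 𝔪_{ℤ̄_p}) : 𝕋(K^p) → ℤ̄_p/𝔪 → k` is continuous for the DISCRETE topology on `k`
  (`𝔪_{ℤ̄_p} ⊂ ℚ̄_p` is the open unit ball, `isOpen_setOf_mem_maximalIdeal_padicAlgClIntegers`);
* `exists_framedGaloisRep_coe_eq_of_isReductionOf` — a reduction `ρ̄ = Q (ρ₀ mod 𝔪) Q⁻¹` of `ρ`
  (`FramedGaloisRep.IsReductionOf`) is continuous for the discrete topology (its kernel is open,
  `FramedGaloisRep.isOpen_ker_of_isReductionOf`, Deligne–Serre 6.12);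
* **`TameLevel.IsAssociated.reduction`** — if `x = x₀ ⊗ ℚ̄_p` is associated with `ρ`, then
  `ψ = ι ∘ (x₀ mod 𝔪)` is associated with every reduction `ρ̄` of `ρ` along `ι : ℤ̄_p/𝔪 → k`:
  `ρ̄` is unramified where `ρ` is, and `charpoly ρ̄(Frob_v)` is the reduction of
  `charpoly ρ(Frob_v) = P_v(x₀) ∈ ℤ̄_p[X]` (`IsReductionOf.hasResidualCharpolys`, injectivity of
  `Polynomial.map ℤ̄_p.subtype`), i.e. `P_v(ψ)`;
* **`TameLevel.IsPadicallyAutomorphic.exists_isResidualRepAt`**,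
  **`TameLevel.IsPadicallyAutomorphic.exists_isNonEisenstein`** — for `ρ` `p`-adically automorphic
  of tame level `𝒰` and any reduction `ρ̄ : Γ_K → GL_n(ℤ̄_p/𝔪)` of `ρ`: the kernel `𝔪_x` of the
  residual eigensystem is an OPEN PRIME ideal of `𝕋(K^p)`, `x₀` is a point over `𝔪_x`
  (`IsPointOver`), `ρ̄` is a residual representation at `𝔪_x` (`IsResidualRepAt`), and if `ρ` is
  residually absolutely irreducible (`FramedGaloisRep.IsResiduallyAbsIrreducible`) then `𝔪_x` is
  NON-EISENSTEIN (`IsNonEisenstein`) — the hypothesis under which the existence statements of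
  `CompletedCohomologyHeckeAlgebraGLnFacts` and [GeeNewton2020, Conj. 3.3.2 (2)] are made.

Maximality of `𝔪_x` (true: `𝕋(K^p)/𝔪_x` embeds in the algebraic extension `ℤ̄_p/𝔪` of `𝔽_p`) is
not proved here.

## References

* F. Calegari, M. Emerton, *Completed cohomology — a survey* (2012), §1.8 (non-Eisenstein
  localisation). [CalegariEmerton2011]
* T. Gee, J. Newton, *Patching and the completed homology of locally symmetric spaces*,
  J. Inst. Math. Jussieu (2020), §2.1.3, §3.3 (points of `𝕋^S(U^p)_𝔪`, Conj. 3.3.2). [GeeNewton2020]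
* C. Khare, J. A. Thorne, *Potential automorphy and the Leopoldt conjecture*, Amer. J. Math. 139
  (2017), §6.5 (integrality of points). [KhareThorne2017]
* L. Pan, *On locally analytic vectors of the completed cohomology of modular curves*, Forum Math.
  Pi 10 (2022), §6.1.1 (`λ : 𝕋(K^p) → ℚ̄_p`, `ρ_λ`, the maximal ideal of `λ`). [Pan2022LocallyAnalytic]
* P. Deligne, J.-P. Serre, Ann. Sci. ÉNS 7 (1974), 6.12 (finite image of `ρ̄`). [DeligneSerreASENS1974]
-/

noncomputable section

open scoped NumberField
open IsDedekindDomain Field Polynomial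
open Literature.NumberTheory.GaloisRepresentations

namespace Literature.NumberTheory.Automorphic

namespace BigHeckeGLn

/-! ### `heckeFrobPoly` under ring homomorphisms -/

/-- `heckeFrobPoly` commutes with ring homomorphisms: `f (P_v(a)) = P_v(f ∘ a)`. [folklore] -/
theorem heckeFrobPoly_map {A B : Type*} [Ring A] [Ring B] (f : A →+* B) (n q : ℕ) (a : ℕ → A) :
    (heckeFrobPoly n q a).map f = heckeFrobPoly n q (fun i => f (a i)) := by
  simp [heckeFrobPoly, Polynomial.map_sum]

/-! ### Continuity of homomorphisms with open kernel (private copies, layering) -/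

/-- A group homomorphism out of a topological group with open kernel is continuous (private copy
of `MonoidHom.continuous_of_isOpen_ker` of `GlobalArtinMapOfCharactersProofs`, not imported here).
[folklore] -/
private theorem continuous_of_isOpen_ker_aux {G H : Type*} [Group G] [TopologicalSpace G]
    [IsTopologicalGroup G] [MulOneClass H] [TopologicalSpace H] [ContinuousMul H] (f : G →* H)
    (hf : IsOpen (f.ker : Set G)) : Continuous f := by
  apply continuous_of_continuousAt_one f
  rw [ContinuousAt, map_one]
  intro U hU
  rw [Filter.mem_map]
  apply Filter.mem_of_superset (hf.mem_nhds (by simp))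
  intro g hg
  rw [SetLike.mem_coe, MonoidHom.mem_ker] at hg
  rw [Set.mem_preimage, hg]
  exact mem_of_mem_nhds hU

/-- Injectivity of `GL_n(f)` for injective `f`. [folklore] -/
private theorem gl_map_injective_of_injective_aux {m : ℕ} {R S : Type*} [CommRing R] [CommRing S]
    {f : R →+* S} (hf : Function.Injective f) :
    Function.Injective (Matrix.GeneralLinearGroup.map (n := Fin m) f) := fun _ _ hgh =>
  Matrix.GeneralLinearGroup.ext fun i j =>
    hf (congrArg (fun u : GL (Fin m) S => (u : Matrix (Fin m) (Fin m) S) i j) hgh)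

/-! ### A reduction of a continuous `ρ : Γ_K → GL_n(ℚ̄_p)` is continuous for the discrete topology -/

section Reduction

variable {K : Type} [Field K] {p : ℕ} [Fact p.Prime] {n : ℕ} {k : Type*} [Field k]

/-- **A reduction of `ρ : Γ_K → GL_n(ℚ̄_p)` is a continuous representation over the DISCRETE residue
field**: if `τ = Q (ρ₀ mod 𝔪) Q⁻¹` for an integral model `ρ₀` of `ρ` (`FramedGaloisRep.IsReductionOf`,
pushed along `ι : ℤ̄_p/𝔪 → k`), then `τ` is continuous for the discrete topology on `k` (its kernel
is open, `FramedGaloisRep.isOpen_ker_of_isReductionOf`), i.e. it is a `FramedGaloisRep K k n`.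
[cite: DeligneSerreASENS1974, 6.12] -/
theorem exists_framedGaloisRep_coe_eq_of_isReductionOf {ρ : FramedGaloisRep K (PadicAlgCl p) n}
    {ι : padicAlgClResidueField p →+* k} {τ : absoluteGaloisGroup K →* GL (Fin n) k}
    (hτ : ρ.IsReductionOf ι τ) :
    letI : TopologicalSpace k := ⊥
    ∃ τ' : FramedGaloisRep K k n, (τ' : absoluteGaloisGroup K →* GL (Fin n) k) = τ := by
  letI : TopologicalSpace k := ⊥
  haveI : DiscreteTopology k := ⟨rfl⟩
  exact ⟨⟨τ, continuous_of_isOpen_ker_aux τ (FramedGaloisRep.isOpen_ker_of_isReductionOf hτ)⟩, rfl⟩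

end Reduction

namespace TameLevel

variable {n : ℕ} {K : Type} [Field K] [NumberField K] {p : ℕ} [Fact p.Prime]
  (𝒰 : TameLevel n K p)

/-! ### Continuous points of `𝕋(K^p)` are integral -/

/-- `p^s = 0` in `End(H^i(X_{U_r}, ℤ/p^s))`, the factor of `𝕋(K^p)` at `(r, s, i)`. [folklore] -/
theorem natCast_pow_endFactor_eq_zero (idx : ℕ × ℕ × ℕ) :
    (p : 𝒰.EndFactor idx) ^ idx.2.1 = 0 := by
  change ((p : Module.End (ZMod (p ^ idx.2.1))
    (levelCohomology (𝒰.tower idx.1) (ZMod (p ^ idx.2.1)) idx.2.2)) ^ idx.2.1) = 0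
  refine LinearMap.ext fun y => ?_
  rw [← Nat.cast_pow, Module.End.natCast_apply, ← Nat.cast_smul_eq_nsmul (ZMod (p ^ idx.2.1)),
    ZMod.natCast_self, zero_smul, LinearMap.zero_apply]

/-- **Continuous points of `𝕋(K^p)` are integral.**  A continuous ring homomorphism
`x : 𝕋(K^p) → A` to a normed division ring of characteristic zero (`ℚ̄_p`, a finite `E/ℚ_p`,
`ℂ_p`, …) satisfies `‖x t‖ ≤ 1` for all `t`: `𝕋(K^p)` carries the subspace topology of the product of
the discrete rings `End(H^i(X_{U_r}, ℤ/p^s))`, in which `p^s = 0`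
(`norm_apply_le_one_of_continuous_of_pow_eq_zero`).  So continuous `ℚ̄_p`-points are `ℤ̄_p`-valued,
as the `𝒪`-valued points of the sources. [cite: KhareThorne2017, §6.5] -/
theorem norm_apply_le_one {A : Type*} [NormedDivisionRing A] [CharZero A]
    (x : CompletedCohomologyHeckeAlgebraGLn 𝒰 →+* A) (hx : Continuous x)
    (t : CompletedCohomologyHeckeAlgebraGLn 𝒰) : ‖x t‖ ≤ 1 :=
  norm_apply_le_one_of_continuous_of_pow_eq_zero 𝒰.bigHeckeSubring x hx
    (Nat.cast_ne_zero.2 (Fact.out : p.Prime).ne_zero) (fun idx : ℕ × ℕ × ℕ => idx.2.1)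
    (fun idx => 𝒰.natCast_pow_endFactor_eq_zero idx) t

/-- A continuous `ℚ̄_p`-point of `𝕋(K^p)` takes values in `ℤ̄_p = padicAlgClIntegers p`.
[cite: KhareThorne2017, §6.5] -/
theorem apply_mem_padicAlgClIntegers (x : CompletedCohomologyHeckeAlgebraGLn 𝒰 →+* PadicAlgCl p)
    (hx : Continuous x) (t : CompletedCohomologyHeckeAlgebraGLn 𝒰) :
    x t ∈ padicAlgClIntegers p := by
  rw [Valuation.mem_valuationSubring_iff, PadicAlgCl.valuation_def, ← NNReal.coe_le_coe,
    coe_nnnorm, NNReal.coe_one]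
  exact 𝒰.norm_apply_le_one x hx t

/-- **The integral corestriction `x₀ : 𝕋(K^p) → ℤ̄_p`** of a continuous `ℚ̄_p`-point `x`: a
continuous ring homomorphism with `x₀ ⊗ ℚ̄_p = x`. [cite: KhareThorne2017, §6.5] -/
theorem exists_integralPoint (x : CompletedCohomologyHeckeAlgebraGLn 𝒰 →+* PadicAlgCl p)
    (hx : Continuous x) :
    ∃ x₀ : CompletedCohomologyHeckeAlgebraGLn 𝒰 →+* padicAlgClIntegers p,
      Continuous x₀ ∧ (padicAlgClIntegers p).subtype.comp x₀ = x :=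
  ⟨x.codRestrict (padicAlgClIntegers p) (𝒰.apply_mem_padicAlgClIntegers x hx),
    hx.subtype_mk _, RingHom.ext fun _ => rfl⟩

/-! ### The residual eigensystem is continuous for the discrete topology -/

/-- **The residual eigensystem `ψ = ι ∘ (x₀ mod 𝔪)` of a continuous `x₀ : 𝕋(K^p) → ℤ̄_p` is
continuous for the DISCRETE topology on `k`**: its fibres are the preimages under
`x = x₀ ⊗ ℚ̄_p` of translates of the open unit ball `𝔪_{ℤ̄_p} ⊂ ℚ̄_p`
(`isOpen_setOf_mem_maximalIdeal_padicAlgClIntegers`). [folklore] -/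
theorem continuous_residue_comp {R : Type*} [Ring R] [TopologicalSpace R]
    (x₀ : R →+* padicAlgClIntegers p) (hx₀ : Continuous x₀)
    {k : Type*} [Field k] (ι : padicAlgClResidueField p →+* k) :
    letI : TopologicalSpace k := ⊥
    Continuous ((ι.comp (IsLocalRing.residue (padicAlgClIntegers p))).comp x₀) := by
  letI : TopologicalSpace k := ⊥
  haveI : DiscreteTopology k := ⟨rfl⟩
  refine continuous_discrete_rng.2 fun b => isOpen_iff_forall_mem_open.2 fun t₀ ht₀ => ?_
  -- the open unit ball `𝔪 ⊂ ℚ̄_p`, translated by `x t₀`, pulled back along `x = x₀ ⊗ ℚ̄_p`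
  set S : Set (PadicAlgCl p) := {y | ∃ h : y ∈ padicAlgClIntegers p,
    (⟨y, h⟩ : padicAlgClIntegers p) ∈ IsLocalRing.maximalIdeal (padicAlgClIntegers p)} with hS
  have hSopen : IsOpen S := isOpen_setOf_mem_maximalIdeal_padicAlgClIntegers
  have hxc : Continuous fun t => ((x₀ t : padicAlgClIntegers p) : PadicAlgCl p) :=
    continuous_subtype_val.comp hx₀
  refine ⟨(fun t => ((x₀ t : padicAlgClIntegers p) : PadicAlgCl p)) ⁻¹'
      ((fun y => y - ((x₀ t₀ : padicAlgClIntegers p) : PadicAlgCl p)) ⁻¹' S), ?_, ?_, ?_⟩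
  · intro t ht
    simp only [Set.mem_preimage, hS, Set.mem_setOf_eq] at ht
    obtain ⟨hmem, hmax⟩ := ht
    have hsub : x₀ t - x₀ t₀ ∈ IsLocalRing.maximalIdeal (padicAlgClIntegers p) := by
      have e : (⟨((x₀ t : padicAlgClIntegers p) : PadicAlgCl p) -
          ((x₀ t₀ : padicAlgClIntegers p) : PadicAlgCl p), hmem⟩ : padicAlgClIntegers p) =
          x₀ t - x₀ t₀ := Subtype.ext rfl
      rw [← e]
      exact hmax
    rw [Set.mem_preimage, Set.mem_singleton_iff] at ht₀ ⊢
    rw [← ht₀, RingHom.comp_apply, RingHom.comp_apply, RingHom.comp_apply, RingHom.comp_apply]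
    congr 1
    rw [← sub_eq_zero, ← map_sub, IsLocalRing.residue_eq_zero_iff]
    exact hsub
  · exact (hSopen.preimage (continuous_id.sub continuous_const)).preimage hxc
  · simp only [Set.mem_preimage, sub_self, hS, Set.mem_setOf_eq]
    exact ⟨Subring.zero_mem _, by
      have e : (⟨(0 : PadicAlgCl p), Subring.zero_mem _⟩ : padicAlgClIntegers p) = 0 := rfl
      rw [e]; exact Ideal.zero_mem _⟩

/-! ### A reduction of `ρ` is associated with the residual eigensystem -/

/-- **Reductions are associated with the residual eigensystem.**  Let `x₀ : 𝕋(K^p) → ℤ̄_p` be such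
that `x = x₀ ⊗ ℚ̄_p` is associated with `ρ : Γ_K → GL_n(ℚ̄_p)` (`TameLevel.IsAssociated`: `ρ`
unramified at `v ∉ S` with `charpoly ρ(Frob_v) = P_v(x)`), and let `ρ̄ : Γ_K → GL_n(k)` be a
reduction of `ρ` along `ι : ℤ̄_p/𝔪 → k` (`FramedGaloisRep.IsReductionOf`), continuous for some
topology on `k`.  Then `ψ = ι ∘ (x₀ mod 𝔪)` is associated with `ρ̄`: inertia at `v ∉ S` is killed by
`ρ`, hence by the integral model `ρ₀ = P⁻¹ ρ P` and by `ρ̄ = Q (ρ₀ mod 𝔪) Q⁻¹`; and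
`charpoly ρ̄(Frob_v)` is the reduction of the integral polynomial `charpoly ρ₀(Frob_v)`
(`IsReductionOf.hasResidualCharpolys`), which is `P_v(x₀)` because `ℤ̄_p[X] → ℚ̄_p[X]` is injective,
so it equals `P_v(ψ)` (`heckeFrobPoly_map`).
[cite: GeeNewton2020, §3.3, Conj. 3.3.2 (1)] [cite: DarmonDiamondTaylor1995, §2.1, p. 54] -/
theorem IsAssociated.reduction {x₀ : CompletedCohomologyHeckeAlgebraGLn 𝒰 →+* padicAlgClIntegers p}
    {ρ : FramedGaloisRep K (PadicAlgCl p) n}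
    (hx : 𝒰.IsAssociated ((padicAlgClIntegers p).subtype.comp x₀) ρ)
    {k : Type*} [Field k] [TopologicalSpace k] {ι : padicAlgClResidueField p →+* k}
    {τ : FramedGaloisRep K k n}
    (hτ : ρ.IsReductionOf ι (τ : absoluteGaloisGroup K →* GL (Fin n) k)) :
    𝒰.IsAssociated ((ι.comp (IsLocalRing.residue (padicAlgClIntegers p))).comp x₀) τ := by
  intro v hv
  obtain ⟨hunr, hchar⟩ := hx v hv
  have hred := hτ.hasResidualCharpolys
  obtain ⟨ρ₀, Q, ⟨P, hP⟩, hQ⟩ := hτ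
  refine ⟨fun 𝔓 h𝔓 σ hσ => ?_, fun 𝔓 h𝔓 σ hσ => ?_⟩
  · -- unramified: `ρ σ = 1 ⟹ ρ₀ σ = 1 ⟹ τ σ = Q 1 Q⁻¹ = 1`
    have hρ : ρ σ = 1 := hunr 𝔓 h𝔓 σ hσ
    have h₀ : ρ₀ σ = 1 := by
      apply gl_map_injective_of_injective_aux (f := (padicAlgClIntegers p).subtype)
        Subtype.val_injective
      rw [hP σ, map_one]
      change P⁻¹ * ρ σ * P = 1
      rw [hρ, mul_one, inv_mul_cancel]
    change (τ : absoluteGaloisGroup K →* GL (Fin n) k) σ = 1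
    rw [hQ σ, integralReduction, MonoidHom.comp_apply, h₀, map_one, mul_one, mul_inv_cancel]
  · -- Frobenius characteristic polynomial
    obtain ⟨Pσ, hPσ, hPσ'⟩ := hred σ
    have hρσ : FramedRep.charpoly ρ σ =
        heckeFrobPoly n (Ideal.absNorm v.asIdeal)
          (fun i => ((padicAlgClIntegers p).subtype.comp x₀) (𝒰.heckeT v i)) := hchar 𝔓 h𝔓 σ hσ
    have hPσeq : Pσ = heckeFrobPoly n (Ideal.absNorm v.asIdeal) (fun i => x₀ (𝒰.heckeT v i)) := by
      apply Polynomial.map_injective (padicAlgClIntegers p).subtype Subtype.val_injective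
      rw [heckeFrobPoly_map, hPσ]
      exact hρσ
    change (((τ : absoluteGaloisGroup K →* GL (Fin n) k) σ : GL (Fin n) k) :
      Matrix (Fin n) (Fin n) k).charpoly = _
    rw [← hPσ', hPσeq, heckeFrobPoly_map]
    rfl

/-! ### Points over the residual kernel; residual representations; non-Eisenstein ideals -/

/-- **The residual eigensystem of a `p`-adically automorphic `ρ` and its residual representation.**
Let `ρ : Γ_K → GL_n(ℚ̄_p)` be `p`-adically automorphic of tame level `𝒰` and let
`ρ̄ : Γ_K → GL_n(ℤ̄_p/𝔪)` be any reduction of `ρ` (`FramedGaloisRep.IsReductionOf` along the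
identity of `ℤ̄_p/𝔪`).  Then there are an integral point `x₀ : 𝕋(K^p) → ℤ̄_p` with `x₀ ⊗ ℚ̄_p`
associated with `ρ`, whose residual eigensystem `ψ = x₀ mod 𝔪 : 𝕋(K^p) → ℤ̄_p/𝔪` (discrete
topology) has an OPEN PRIME kernel `𝔪_x`, such that `x₀` is a point over `𝔪_x` (`IsPointOver`) and
`ρ̄` — continuous for the discrete topology — is a residual representation at `𝔪_x`
(`IsResidualRepAt 𝔪_x ψ ρ̄`).
[cite: GeeNewton2020, §2.1.3 and §3.3, Conj. 3.3.2 (1)] [cite: Pan2022LocallyAnalytic, §6.1.1] -/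
theorem IsPadicallyAutomorphic.exists_isResidualRepAt {ρ : FramedGaloisRep K (PadicAlgCl p) n}
    (hρ : 𝒰.IsPadicallyAutomorphic ρ)
    {τ : absoluteGaloisGroup K →* GL (Fin n) (padicAlgClResidueField p)}
    (hτ : ρ.IsReductionOf (RingHom.id _) τ) :
    letI : TopologicalSpace (padicAlgClResidueField p) := ⊥
    ∃ (x₀ : CompletedCohomologyHeckeAlgebraGLn 𝒰 →+* padicAlgClIntegers p)
      (τ' : FramedGaloisRep K (padicAlgClResidueField p) n),
      𝒰.IsAssociated ((padicAlgClIntegers p).subtype.comp x₀) ρ ∧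
      (τ' : absoluteGaloisGroup K →* GL (Fin n) (padicAlgClResidueField p)) = τ ∧
      IsOpen ((RingHom.ker ((IsLocalRing.residue (padicAlgClIntegers p)).comp x₀) :
        Ideal (CompletedCohomologyHeckeAlgebraGLn 𝒰)) : Set (CompletedCohomologyHeckeAlgebraGLn 𝒰)) ∧
      (RingHom.ker ((IsLocalRing.residue (padicAlgClIntegers p)).comp x₀)).IsPrime ∧
      𝒰.IsPointOver (RingHom.ker ((IsLocalRing.residue (padicAlgClIntegers p)).comp x₀)) x₀ ∧
      𝒰.IsResidualRepAt (RingHom.ker ((IsLocalRing.residue (padicAlgClIntegers p)).comp x₀))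
        ((IsLocalRing.residue (padicAlgClIntegers p)).comp x₀) τ' := by
  letI : TopologicalSpace (padicAlgClResidueField p) := ⊥
  haveI : DiscreteTopology (padicAlgClResidueField p) := ⟨rfl⟩
  obtain ⟨x, hxc, hx⟩ := hρ
  obtain ⟨x₀, hx₀c, hx₀⟩ := 𝒰.exists_integralPoint x hxc
  rw [← hx₀] at hx
  obtain ⟨τ', hτ'⟩ := exists_framedGaloisRep_coe_eq_of_isReductionOf hτ
  have hψc : Continuous ((IsLocalRing.residue (padicAlgClIntegers p)).comp x₀) := by
    have h := continuous_residue_comp x₀ hx₀c (RingHom.id (padicAlgClResidueField p))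
    rwa [RingHom.id_comp] at h
  have hassoc : 𝒰.IsAssociated ((IsLocalRing.residue (padicAlgClIntegers p)).comp x₀) τ' := by
    have h := IsAssociated.reduction 𝒰 hx (ι := RingHom.id _) (τ := τ') (hτ' ▸ hτ)
    rwa [RingHom.id_comp] at h
  refine ⟨x₀, τ', hx, hτ', ?_, RingHom.ker_isPrime _, ⟨hx₀c, ?_⟩, ⟨hψc, rfl, hassoc⟩⟩
  · have e : ((RingHom.ker ((IsLocalRing.residue (padicAlgClIntegers p)).comp x₀) :
        Ideal (CompletedCohomologyHeckeAlgebraGLn 𝒰)) : Set (CompletedCohomologyHeckeAlgebraGLn 𝒰)) =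
        ((IsLocalRing.residue (padicAlgClIntegers p)).comp x₀) ⁻¹' {0} := by
      ext t
      rw [SetLike.mem_coe, RingHom.mem_ker, Set.mem_preimage, Set.mem_singleton_iff]
    rw [e]
    exact (isOpen_discrete _).preimage hψc
  · rw [← RingHom.comap_ker, IsLocalRing.ker_residue]

/-- **`p`-adically automorphic and residually absolutely irreducible ⟹ the residual eigensystem is
a non-Eisenstein ideal.**  If `ρ : Γ_K → GL_n(ℚ̄_p)` is `p`-adically automorphic of tame level `𝒰`
(`IsPadicallyAutomorphic`) and some reduction `ρ̄` of `ρ` is absolutely irreducible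
(`FramedGaloisRep.IsResiduallyAbsIrreducible`), then there are an open prime ideal
`𝔪 ⊂ 𝕋(K^p)` which is NON-EISENSTEIN (`IsNonEisenstein 𝔪`: `ρ̄`, continuous for the discrete
topology on `ℤ̄_p/𝔪`, is an absolutely irreducible residual representation at `𝔪`) and an integral
point `x₀ : 𝕋(K^p) → ℤ̄_p` over `𝔪` (`IsPointOver 𝔪 x₀`) with `x₀ ⊗ ℚ̄_p` associated with `ρ` — the
"non-Eisenstein maximal ideal of `ρ̄`" at which the sources localise.
[cite: CalegariEmerton2011, §1.8] [cite: GeeNewton2020, §3.3 (standing hypotheses after Def. 3.3.4)] -/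
theorem IsPadicallyAutomorphic.exists_isNonEisenstein {ρ : FramedGaloisRep K (PadicAlgCl p) n}
    (hρ : 𝒰.IsPadicallyAutomorphic ρ) (hirr : ρ.IsResiduallyAbsIrreducible) :
    ∃ (𝔪 : Ideal (CompletedCohomologyHeckeAlgebraGLn 𝒰))
      (x₀ : CompletedCohomologyHeckeAlgebraGLn 𝒰 →+* padicAlgClIntegers p),
      IsOpen (𝔪 : Set (CompletedCohomologyHeckeAlgebraGLn 𝒰)) ∧ 𝔪.IsPrime ∧
      𝒰.IsNonEisenstein 𝔪 ∧ 𝒰.IsPointOver 𝔪 x₀ ∧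
      𝒰.IsAssociated ((padicAlgClIntegers p).subtype.comp x₀) ρ := by
  letI : TopologicalSpace (padicAlgClResidueField p) := ⊥
  haveI : DiscreteTopology (padicAlgClResidueField p) := ⟨rfl⟩
  obtain ⟨τ, hτ, habs⟩ := hirr
  obtain ⟨x₀, τ', hx, hτ', hopen, hprime, hpt, hres⟩ := hρ.exists_isResidualRepAt 𝒰 hτ
  refine ⟨_, x₀, hopen, hprime, ⟨padicAlgClResidueField p, inferInstance, ⊥, ⟨rfl⟩, _, τ', hres,
    ?_⟩, hpt, hx⟩
  rw [FramedRep.isAbsolutelyIrreducible_iff_coe, hτ']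
  exact habs

end TameLevel

end BigHeckeGLn

end Literature.NumberTheory.Automorphic
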